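import Summits.BirchSwinnertonDyer.Rank1Residual.X12.JZeroThreeDescent
import Summits.BirchSwinnertonDyer.Rank1Residual.X12.InertCoreInstancesA
import Summits.BirchSwinnertonDyer.Rank1Residual.X12.FrobeniusIrrRecords
import Summits.BirchSwinnertonDyer.Rank1Residual.X12.InertCoreInstancesG
import HarnessLib

/-!
# K12r@3 (`j = 0`, CM by `ℚ(√−3)`, `ord_{s=1} L(E,s) = 1`, `p = 3` RAMIFIED): per-class kernel records (E)
# — `7056bf1`, `7056bg1`, `7056bh1`, `7569a1`, `7803a1`, `7803c1`, `7803q1`, `7803r1`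
# (cell `bsd-print-cfram`, seat p4; window `N < 2·10⁴` of the leaf `WAllCornerFRamifiedAtThree`)

HONEST FRAMING (cell `bsd-print-cfram`, run/shared/lean/pub/bsd-print-cfram/, D-0131 (2) print
tier; verbatim in every file of the seat): the cell works the partition leaf
`CornerF ∧ p ramified in the CM field K` (LADDER-BSD row K7r = B13; W-ALL row 12r) in PARTITION
currency — a leaf or a cell counts only when its theorem is in the kernel BY NAME. NO class-wide
theorem for the `p = 3` slice is in print (bsd-wall-cm K12R3-SCOPING-v1 §3); these are PER-CLASS
records, one per isogeny class of the window `N < 2·10⁴` not already booked through a printed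
family (Kriz–Li sextic twists / cube sums: 13 classes), in the booking shape of
`X12/JZeroThreeDescent.lean` (`JZeroThree.bsdp_three_of_noThreeTorsion`, seam
`X12.bsdp_of_sha_torsion_eq_zero` p220351). Definitions = Cremona's minimal models (data);
theorems only otherwise; no named fact; nothing about any curve is ASSERTED — the per-class inputs
enter as hypotheses: `hr` (`ord_{s=1} L(E,s) ≤ 1`; Cremona: `= 1`), `h0` (`Ш(E/ℚ)[3] = 0`: the
CERTIFICATE), `hq`/`hv` (`#Ш_an(E) = q`, `ord₃ q = 0`; Cremona: `#Ш_an = 1` on every member of every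
class below). beyond-print: NO (certificate assembly).

THE CERTIFICATE behind `h0` (two engines, two seats, two code bases; numbers quoted per record):
the `3`-isogeny descent along `φ : E_k → E_{−27k}` (`E_k : y² = x³ + k` the `j = 0` member,
kernel `⟨(0, ±√k)⟩`): `s_φ = dim_𝔽₃ Sel^φ(E_k)`, `s_φ̂ = dim_𝔽₃ Sel^φ̂(E_{−27k})`,
`m = rank + [k ∈ ℚ²] + [−3k ∈ ℚ²]`, `EXCESS = s_φ + s_φ̂ − m = dim Ш(E_k)[φ] + dim Ш(E_{−27k})[φ̂]`;
EXCESS `0` ⟹ `Ш(E_k)[3] = 0 = Ш(E_{−27k})[3]`. Engine 1: x1b `x12sel3.gp` (Kummer images in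
`K(S′,3)`, `bnfcertify`d, local images to the printed size [Schaefer 1996 L.3.8 = BES 2020 Prop. 27],
Cassels' Selmer-ratio identity and BES Prop. 28 checked on every edge), kit j101548 = j101531;
engine 2: sha-2 `iso3kum.gp` run by harvest-1, kit j103487 = j103505; the two engines agree on
`(s_φ, s_φ̂)` on all 1838 members of the 919 classes `N < 5·10⁵` (x1b X12-ROUTE.md §17, harvest-1
GEN 25). `Ш(E)[3] = 0` is a `ℚ`-isogeny invariant inside these classes only through BSD — the record
states it for Cremona's curve 1 (= a `j = 0` member `E_k` up to `ℚ`-isomorphism, `k` quoted), on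
which both engines computed it directly.

Per record: model (new, or REUSED by name with its instances), `IsElliptic`, `IsGloballyMinimal`
(Kraus–Silverman, kernel-decided), `j = 0`, the leaf cell `cornerF_three_<name>`, and
`bsdp_three_<name>` = `BSD(E, 3) ∧ #Ш(E/ℚ)[3^∞] = 1` under `hGZK`, `hr`, `h0`, `hq`, `hv`; the class
form is `JZeroThree.bsdp_three_of_isIsogenous_of_noThreeTorsion` on the same hypotheses.

References: `X12/JZeroThreeDescent.lean`; `X12/MillerStollRecords.lean` §1; `X12/InertCoreInstancesA.lean`
§0 (record conventions); [cite: Cremona1997, Table 1]; [cite: Miller2011LMS, §1 and Def. 1.1];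
[cite: SilvermanAEC2009, VII.1 Remark 1.1 and X.4]; x1b `gen13/sel3j0/SEL3J0-MEMBERS-1838.tsv`
(sha256 in that folder's SHA256SUMS).
-/

set_option autoImplicit false

noncomputable section

open scoped Classical

open WeierstrassCurve Literature.NumberTheory.EllipticCurves
  Literature.NumberTheory.EllipticCurves.ModularForms
  Literature.NumberTheory.EllipticCurves.Rank1Residual
  Literature.NumberTheory.EllipticCurves.Rank1Residual.Typed
  Literature.NumberTheory.EllipticCurves.Rank1Residual.X11RankOneCertificates
  Summit.BirchSwinnertonDyer.BirchSwinnertonDyer.Rank1Residual.X11RankOne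
  Summit.BirchSwinnertonDyer.Rank1Residual.X11b

namespace Summit.BirchSwinnertonDyer.Rank1Residual.X12

/-! ### `7056bf1 @ 3` (class `7056bf`, `N = 7056 = 2⁴·3²·7²`) -/
namespace Records
/-- Cremona `7056bf1 = [0, 0, 0, 0, 343]`: `y² = x³ + 343` (`N = 7056 = 2⁴·3²·7²`, `j = 0`, CM by `ℤ[ζ₃]`;
`≅ E_k : y² = x³ + k` with `k = 343`; Cremona: rank `1`, `#E(ℚ)_tors = 2`, `∏ c_ℓ = 8`,
`#Ш_an = 1`). [cite: Cremona1997, Table 1 (curve 7056bf1)] -/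
def c7056bf1 : WeierstrassCurve ℚ := ⟨0, 0, 0, 0, 343⟩

/-- `7056bf1` is an elliptic curve (`Δ = -50824368 ≠ 0`). [cite: SilvermanAEC2009, III.1] -/
instance isElliptic_c7056bf1 : c7056bf1.IsElliptic := by
  have h := isElliptic_of_discOf_ne_zero 0 0 0 0 343 (by decide)
  norm_num at h; exact h

set_option maxRecDepth 100000 in
/-- `[0, 0, 0, 0, 343]` is globally minimal (`Δ = -50824368`; Kraus–Silverman criterion, kernel-decided).
[cite: SilvermanAEC2009, VII.1 Remark 1.1 and VIII.8] -/
instance isGloballyMinimal_c7056bf1 : c7056bf1.IsGloballyMinimal := by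
  have h := isGloballyMinimal_of_krausCriterion_bounded 0 0 0 0 343
    (by decide) (by decide) (by decide +kernel)
  norm_num at h; exact h

/-- `j(7056bf1) = 0` (`c₄ = 0`). [cite: Cremona1997, Table 1 (curve 7056bf1)] -/
theorem c7056bf1_j : c7056bf1.j = 0 := by
  have hc4 : c7056bf1.c₄ = 0 := by
    norm_num [c7056bf1, WeierstrassCurve.c₄, WeierstrassCurve.b₂, WeierstrassCurve.b₄]
  rw [WeierstrassCurve.j, hc4]
  simp

end Records

/-- **`(7056bf1, 3)` is a cell of the leaf `CornerF ∧ CMRamified` at `3`** (CM by `ℚ(√−3)`,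
`r_an = 1`, `3` bad and ramified), given `ord_{s=1} L(E,s) = 1` (`hr`; Cremona). [folklore] -/
theorem cornerF_three_c7056bf1 (hr : Records.c7056bf1.analyticRank = 1) : CornerF Records.c7056bf1 3 :=
  JZeroThree.cornerF_three_of_j_eq_zero _ Records.c7056bf1_j hr

/-- **`BSD(7056bf1, 3)` and `#Ш(7056bf1/ℚ)[3^∞] = 1`** from GZK (`hGZK`), `ord_{s=1} L(E,s) ≤ 1`
(`hr`), the two-engine `3`-isogeny-descent certificate `Ш(E/ℚ)[3] = 0` (`h0`; 7056bf1: k = 343, (s_φ, s_φ̂, m, EXCESS) = (0, 1, 1, 0); 7056bf3: k = -9261, (s_φ, s_φ̂, m, EXCESS) = (1, 0, 1, 0);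
engines x1b j101548 / sha-2 j103487, agreeing) and `#Ш_an = q`, `ord₃ q = 0` (`hq`, `hv`; Cremona
`#Ш_an`: 7056bf1 1, 7056bf2 1, 7056bf3 1, 7056bf4 1). PER CLASS; nothing asserted. [cite: Miller2011LMS, §1 and Def. 1.1]
[cite: Cremona1997, Table 1 (class 7056bf)] -/
theorem bsdp_three_c7056bf1 (hGZK : rank_eq_analyticRank_of_analyticRank_le_one)
    (hr : Records.c7056bf1.analyticRank ≤ 1) (h0 : ∀ x : ↥Records.c7056bf1.sha, 3 • x = 0 → x = 0)
    {q : ℚ} (hq : shaAn Records.c7056bf1 = (q : ℂ)) (hv : padicValRat 3 q = 0) :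
    BSDp Records.c7056bf1 3 ∧ Nat.card (AddCommGroup.primaryComponent Records.c7056bf1.sha 3) = 1 :=
  JZeroThree.bsdp_three_of_noThreeTorsion _ hGZK hr h0 hq hv

/-! ### `7056bg1 @ 3` (class `7056bg`, `N = 7056 = 2⁴·3²·7²`) -/
namespace Records
/-- Cremona `7056bg1 = [0, 0, 0, 0, 28]`: `y² = x³ + 28` (`N = 7056 = 2⁴·3²·7²`, `j = 0`, CM by `ℤ[ζ₃]`;
`≅ E_k : y² = x³ + k` with `k = 28`; Cremona: rank `1`, `#E(ℚ)_tors = 1`, `∏ c_ℓ = 4`,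
`#Ш_an = 1`). [cite: Cremona1997, Table 1 (curve 7056bg1)] -/
def c7056bg1 : WeierstrassCurve ℚ := ⟨0, 0, 0, 0, 28⟩

/-- `7056bg1` is an elliptic curve (`Δ = -338688 ≠ 0`). [cite: SilvermanAEC2009, III.1] -/
instance isElliptic_c7056bg1 : c7056bg1.IsElliptic := by
  have h := isElliptic_of_discOf_ne_zero 0 0 0 0 28 (by decide)
  norm_num at h; exact h

set_option maxRecDepth 100000 in
/-- `[0, 0, 0, 0, 28]` is globally minimal (`Δ = -338688`; Kraus–Silverman criterion, kernel-decided).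
[cite: SilvermanAEC2009, VII.1 Remark 1.1 and VIII.8] -/
instance isGloballyMinimal_c7056bg1 : c7056bg1.IsGloballyMinimal := by
  have h := isGloballyMinimal_of_krausCriterion_bounded 0 0 0 0 28
    (by decide) (by decide) (by decide +kernel)
  norm_num at h; exact h

/-- `j(7056bg1) = 0` (`c₄ = 0`). [cite: Cremona1997, Table 1 (curve 7056bg1)] -/
theorem c7056bg1_j : c7056bg1.j = 0 := by
  have hc4 : c7056bg1.c₄ = 0 := by
    norm_num [c7056bg1, WeierstrassCurve.c₄, WeierstrassCurve.b₂, WeierstrassCurve.b₄]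
  rw [WeierstrassCurve.j, hc4]
  simp

end Records

/-- **`(7056bg1, 3)` is a cell of the leaf `CornerF ∧ CMRamified` at `3`** (CM by `ℚ(√−3)`,
`r_an = 1`, `3` bad and ramified), given `ord_{s=1} L(E,s) = 1` (`hr`; Cremona). [folklore] -/
theorem cornerF_three_c7056bg1 (hr : Records.c7056bg1.analyticRank = 1) : CornerF Records.c7056bg1 3 :=
  JZeroThree.cornerF_three_of_j_eq_zero _ Records.c7056bg1_j hr

/-- **`BSD(7056bg1, 3)` and `#Ш(7056bg1/ℚ)[3^∞] = 1`** from GZK (`hGZK`), `ord_{s=1} L(E,s) ≤ 1`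
(`hr`), the two-engine `3`-isogeny-descent certificate `Ш(E/ℚ)[3] = 0` (`h0`; 7056bg1: k = 28, (s_φ, s_φ̂, m, EXCESS) = (0, 1, 1, 0); 7056bg2: k = -756, (s_φ, s_φ̂, m, EXCESS) = (1, 0, 1, 0);
engines x1b j101548 / sha-2 j103487, agreeing) and `#Ш_an = q`, `ord₃ q = 0` (`hq`, `hv`; Cremona
`#Ш_an`: 7056bg1 1, 7056bg2 1). PER CLASS; nothing asserted. [cite: Miller2011LMS, §1 and Def. 1.1]
[cite: Cremona1997, Table 1 (class 7056bg)] -/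
theorem bsdp_three_c7056bg1 (hGZK : rank_eq_analyticRank_of_analyticRank_le_one)
    (hr : Records.c7056bg1.analyticRank ≤ 1) (h0 : ∀ x : ↥Records.c7056bg1.sha, 3 • x = 0 → x = 0)
    {q : ℚ} (hq : shaAn Records.c7056bg1 = (q : ℂ)) (hv : padicValRat 3 q = 0) :
    BSDp Records.c7056bg1 3 ∧ Nat.card (AddCommGroup.primaryComponent Records.c7056bg1.sha 3) = 1 :=
  JZeroThree.bsdp_three_of_noThreeTorsion _ hGZK hr h0 hq hv

/-! ### `7056bh1 @ 3` (class `7056bh`, `N = 7056 = 2⁴·3²·7²`) -/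
namespace Records
/-- Cremona `7056bh1 = [0, 0, 0, 0, 268912]`: `y² = x³ + 268912` (`N = 7056 = 2⁴·3²·7²`, `j = 0`, CM by `ℤ[ζ₃]`;
`≅ E_k : y² = x³ + k` with `k = 268912`; Cremona: rank `1`, `#E(ℚ)_tors = 1`, `∏ c_ℓ = 2`,
`#Ш_an = 1`). [cite: Cremona1997, Table 1 (curve 7056bh1)] -/
def c7056bh1 : WeierstrassCurve ℚ := ⟨0, 0, 0, 0, 268912⟩

/-- `7056bh1` is an elliptic curve (`Δ = -31239502737408 ≠ 0`). [cite: SilvermanAEC2009, III.1] -/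
instance isElliptic_c7056bh1 : c7056bh1.IsElliptic := by
  have h := isElliptic_of_discOf_ne_zero 0 0 0 0 268912 (by decide)
  norm_num at h; exact h

set_option maxRecDepth 100000 in
/-- `[0, 0, 0, 0, 268912]` is globally minimal (`Δ = -31239502737408`; Kraus–Silverman criterion, kernel-decided).
[cite: SilvermanAEC2009, VII.1 Remark 1.1 and VIII.8] -/
instance isGloballyMinimal_c7056bh1 : c7056bh1.IsGloballyMinimal := by
  have h := isGloballyMinimal_of_krausCriterion_bounded 0 0 0 0 268912
    (by decide) (by decide) (by decide +kernel)
  norm_num at h; exact h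

/-- `j(7056bh1) = 0` (`c₄ = 0`). [cite: Cremona1997, Table 1 (curve 7056bh1)] -/
theorem c7056bh1_j : c7056bh1.j = 0 := by
  have hc4 : c7056bh1.c₄ = 0 := by
    norm_num [c7056bh1, WeierstrassCurve.c₄, WeierstrassCurve.b₂, WeierstrassCurve.b₄]
  rw [WeierstrassCurve.j, hc4]
  simp

end Records

/-- **`(7056bh1, 3)` is a cell of the leaf `CornerF ∧ CMRamified` at `3`** (CM by `ℚ(√−3)`,
`r_an = 1`, `3` bad and ramified), given `ord_{s=1} L(E,s) = 1` (`hr`; Cremona). [folklore] -/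
theorem cornerF_three_c7056bh1 (hr : Records.c7056bh1.analyticRank = 1) : CornerF Records.c7056bh1 3 :=
  JZeroThree.cornerF_three_of_j_eq_zero _ Records.c7056bh1_j hr

/-- **`BSD(7056bh1, 3)` and `#Ш(7056bh1/ℚ)[3^∞] = 1`** from GZK (`hGZK`), `ord_{s=1} L(E,s) ≤ 1`
(`hr`), the two-engine `3`-isogeny-descent certificate `Ш(E/ℚ)[3] = 0` (`h0`; 7056bh1: k = 268912, (s_φ, s_φ̂, m, EXCESS) = (0, 1, 1, 0); 7056bh2: k = -7260624, (s_φ, s_φ̂, m, EXCESS) = (1, 0, 1, 0);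
engines x1b j101548 / sha-2 j103487, agreeing) and `#Ш_an = q`, `ord₃ q = 0` (`hq`, `hv`; Cremona
`#Ш_an`: 7056bh1 1, 7056bh2 1). PER CLASS; nothing asserted. [cite: Miller2011LMS, §1 and Def. 1.1]
[cite: Cremona1997, Table 1 (class 7056bh)] -/
theorem bsdp_three_c7056bh1 (hGZK : rank_eq_analyticRank_of_analyticRank_le_one)
    (hr : Records.c7056bh1.analyticRank ≤ 1) (h0 : ∀ x : ↥Records.c7056bh1.sha, 3 • x = 0 → x = 0)
    {q : ℚ} (hq : shaAn Records.c7056bh1 = (q : ℂ)) (hv : padicValRat 3 q = 0) :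
    BSDp Records.c7056bh1 3 ∧ Nat.card (AddCommGroup.primaryComponent Records.c7056bh1.sha 3) = 1 :=
  JZeroThree.bsdp_three_of_noThreeTorsion _ hGZK hr h0 hq hv

/-! ### `7569a1 @ 3` (class `7569a`, `N = 7569 = 3²·29²`) -/
namespace Records
/-! Model `cremona7569a1 = [0, 0, 1, 0, 5127787]` (`y² + y = x³ + 5127787`; `k = 328178384`; Cremona: rank `1`, `#E(ℚ)_tors = 1`,
`∏ c_ℓ = 2`, `#Ш_an = 1`) with its `IsElliptic` / `IsGloballyMinimal` instances is REUSED from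
`FrobeniusIrrRecords.lean`. -/

/-- `j(7569a1) = 0` (`c₄ = 0`). [cite: Cremona1997, Table 1 (curve 7569a1)] -/
theorem cremona7569a1_j : cremona7569a1.j = 0 := by
  have hc4 : cremona7569a1.c₄ = 0 := by
    norm_num [cremona7569a1, WeierstrassCurve.c₄, WeierstrassCurve.b₂, WeierstrassCurve.b₄]
  rw [WeierstrassCurve.j, hc4]
  simp

end Records

/-- **`(7569a1, 3)` is a cell of the leaf `CornerF ∧ CMRamified` at `3`** (CM by `ℚ(√−3)`,
`r_an = 1`, `3` bad and ramified), given `ord_{s=1} L(E,s) = 1` (`hr`; Cremona). [folklore] -/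
theorem cornerF_three_cremona7569a1 (hr : Records.cremona7569a1.analyticRank = 1) : CornerF Records.cremona7569a1 3 :=
  JZeroThree.cornerF_three_of_j_eq_zero _ Records.cremona7569a1_j hr

/-- **`BSD(7569a1, 3)` and `#Ш(7569a1/ℚ)[3^∞] = 1`** from GZK (`hGZK`), `ord_{s=1} L(E,s) ≤ 1`
(`hr`), the two-engine `3`-isogeny-descent certificate `Ш(E/ℚ)[3] = 0` (`h0`; 7569a1: k = 328178384, (s_φ, s_φ̂, m, EXCESS) = (0, 1, 1, 0); 7569a2: k = -8860816368, (s_φ, s_φ̂, m, EXCESS) = (1, 0, 1, 0);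
engines x1b j101548 / sha-2 j103487, agreeing) and `#Ш_an = q`, `ord₃ q = 0` (`hq`, `hv`; Cremona
`#Ш_an`: 7569a1 1, 7569a2 1). PER CLASS; nothing asserted. [cite: Miller2011LMS, §1 and Def. 1.1]
[cite: Cremona1997, Table 1 (class 7569a)] -/
theorem bsdp_three_cremona7569a1 (hGZK : rank_eq_analyticRank_of_analyticRank_le_one)
    (hr : Records.cremona7569a1.analyticRank ≤ 1) (h0 : ∀ x : ↥Records.cremona7569a1.sha, 3 • x = 0 → x = 0)
    {q : ℚ} (hq : shaAn Records.cremona7569a1 = (q : ℂ)) (hv : padicValRat 3 q = 0) :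
    BSDp Records.cremona7569a1 3 ∧ Nat.card (AddCommGroup.primaryComponent Records.cremona7569a1.sha 3) = 1 :=
  JZeroThree.bsdp_three_of_noThreeTorsion _ hGZK hr h0 hq hv

/-! ### `7803a1 @ 3` (class `7803a`, `N = 7803 = 3³·17²`) -/
namespace Records
/-! Model `c7803a1 = [0, 0, 1, 0, 1228]` (`y² + y = x³ + 1228`; `k = 78608`; Cremona: rank `1`, `#E(ℚ)_tors = 1`,
`∏ c_ℓ = 2`, `#Ш_an = 1`) with its `IsElliptic` / `IsGloballyMinimal` instances is REUSED from
`InertCoreInstancesG.lean`. -/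

/-- `j(7803a1) = 0` (`c₄ = 0`). [cite: Cremona1997, Table 1 (curve 7803a1)] -/
theorem c7803a1_j : c7803a1.j = 0 := by
  have hc4 : c7803a1.c₄ = 0 := by
    norm_num [c7803a1, WeierstrassCurve.c₄, WeierstrassCurve.b₂, WeierstrassCurve.b₄]
  rw [WeierstrassCurve.j, hc4]
  simp

end Records

/-- **`(7803a1, 3)` is a cell of the leaf `CornerF ∧ CMRamified` at `3`** (CM by `ℚ(√−3)`,
`r_an = 1`, `3` bad and ramified), given `ord_{s=1} L(E,s) = 1` (`hr`; Cremona). [folklore] -/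
theorem cornerF_three_c7803a1 (hr : Records.c7803a1.analyticRank = 1) : CornerF Records.c7803a1 3 :=
  JZeroThree.cornerF_three_of_j_eq_zero _ Records.c7803a1_j hr

/-- **`BSD(7803a1, 3)` and `#Ш(7803a1/ℚ)[3^∞] = 1`** from GZK (`hGZK`), `ord_{s=1} L(E,s) ≤ 1`
(`hr`), the two-engine `3`-isogeny-descent certificate `Ш(E/ℚ)[3] = 0` (`h0`; 7803a1: k = 78608, (s_φ, s_φ̂, m, EXCESS) = (0, 1, 1, 0); 7803a2: k = -2122416, (s_φ, s_φ̂, m, EXCESS) = (1, 0, 1, 0);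
engines x1b j101548 / sha-2 j103487, agreeing) and `#Ш_an = q`, `ord₃ q = 0` (`hq`, `hv`; Cremona
`#Ш_an`: 7803a1 1, 7803a2 1, 7803a3 1, 7803a4 1). PER CLASS; nothing asserted. [cite: Miller2011LMS, §1 and Def. 1.1]
[cite: Cremona1997, Table 1 (class 7803a)] -/
theorem bsdp_three_c7803a1 (hGZK : rank_eq_analyticRank_of_analyticRank_le_one)
    (hr : Records.c7803a1.analyticRank ≤ 1) (h0 : ∀ x : ↥Records.c7803a1.sha, 3 • x = 0 → x = 0)
    {q : ℚ} (hq : shaAn Records.c7803a1 = (q : ℂ)) (hv : padicValRat 3 q = 0) :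
    BSDp Records.c7803a1 3 ∧ Nat.card (AddCommGroup.primaryComponent Records.c7803a1.sha 3) = 1 :=
  JZeroThree.bsdp_three_of_noThreeTorsion _ hGZK hr h0 hq hv

/-! ### `7803c1 @ 3` (class `7803c`, `N = 7803 = 3³·17²`) -/
namespace Records
/-! Model `c7803c1 = [0, 0, 1, 0, 354964]` (`y² + y = x³ + 354964`; `k = 22717712`; Cremona: rank `1`, `#E(ℚ)_tors = 1`,
`∏ c_ℓ = 1`, `#Ш_an = 1`) with its `IsElliptic` / `IsGloballyMinimal` instances is REUSED from
`InertCoreInstancesG.lean`. -/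

/-- `j(7803c1) = 0` (`c₄ = 0`). [cite: Cremona1997, Table 1 (curve 7803c1)] -/
theorem c7803c1_j : c7803c1.j = 0 := by
  have hc4 : c7803c1.c₄ = 0 := by
    norm_num [c7803c1, WeierstrassCurve.c₄, WeierstrassCurve.b₂, WeierstrassCurve.b₄]
  rw [WeierstrassCurve.j, hc4]
  simp

end Records

/-- **`(7803c1, 3)` is a cell of the leaf `CornerF ∧ CMRamified` at `3`** (CM by `ℚ(√−3)`,
`r_an = 1`, `3` bad and ramified), given `ord_{s=1} L(E,s) = 1` (`hr`; Cremona). [folklore] -/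
theorem cornerF_three_c7803c1 (hr : Records.c7803c1.analyticRank = 1) : CornerF Records.c7803c1 3 :=
  JZeroThree.cornerF_three_of_j_eq_zero _ Records.c7803c1_j hr

/-- **`BSD(7803c1, 3)` and `#Ш(7803c1/ℚ)[3^∞] = 1`** from GZK (`hGZK`), `ord_{s=1} L(E,s) ≤ 1`
(`hr`), the two-engine `3`-isogeny-descent certificate `Ш(E/ℚ)[3] = 0` (`h0`; 7803c1: k = 22717712, (s_φ, s_φ̂, m, EXCESS) = (0, 1, 1, 0); 7803c2: k = -613378224, (s_φ, s_φ̂, m, EXCESS) = (1, 0, 1, 0);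
engines x1b j101548 / sha-2 j103487, agreeing) and `#Ш_an = q`, `ord₃ q = 0` (`hq`, `hv`; Cremona
`#Ш_an`: 7803c1 1, 7803c2 1). PER CLASS; nothing asserted. [cite: Miller2011LMS, §1 and Def. 1.1]
[cite: Cremona1997, Table 1 (class 7803c)] -/
theorem bsdp_three_c7803c1 (hGZK : rank_eq_analyticRank_of_analyticRank_le_one)
    (hr : Records.c7803c1.analyticRank ≤ 1) (h0 : ∀ x : ↥Records.c7803c1.sha, 3 • x = 0 → x = 0)
    {q : ℚ} (hq : shaAn Records.c7803c1 = (q : ℂ)) (hv : padicValRat 3 q = 0) :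
    BSDp Records.c7803c1 3 ∧ Nat.card (AddCommGroup.primaryComponent Records.c7803c1.sha 3) = 1 :=
  JZeroThree.bsdp_three_of_noThreeTorsion _ hGZK hr h0 hq hv

/-! ### `7803q1 @ 3` (class `7803q`, `N = 7803 = 3³·17²`) -/
namespace Records
/-! Model `c7803q1 = [0, 0, 1, 0, 20880]` (`y² + y = x³ + 20880`; `k = 1336336`; Cremona: rank `1`, `#E(ℚ)_tors = 3`,
`∏ c_ℓ = 3`, `#Ш_an = 1`) with its `IsElliptic` / `IsGloballyMinimal` instances is REUSED from
`InertCoreInstancesG.lean`. -/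

/-- `j(7803q1) = 0` (`c₄ = 0`). [cite: Cremona1997, Table 1 (curve 7803q1)] -/
theorem c7803q1_j : c7803q1.j = 0 := by
  have hc4 : c7803q1.c₄ = 0 := by
    norm_num [c7803q1, WeierstrassCurve.c₄, WeierstrassCurve.b₂, WeierstrassCurve.b₄]
  rw [WeierstrassCurve.j, hc4]
  simp

end Records

/-- **`(7803q1, 3)` is a cell of the leaf `CornerF ∧ CMRamified` at `3`** (CM by `ℚ(√−3)`,
`r_an = 1`, `3` bad and ramified), given `ord_{s=1} L(E,s) = 1` (`hr`; Cremona). [folklore] -/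
theorem cornerF_three_c7803q1 (hr : Records.c7803q1.analyticRank = 1) : CornerF Records.c7803q1 3 :=
  JZeroThree.cornerF_three_of_j_eq_zero _ Records.c7803q1_j hr

/-- **`BSD(7803q1, 3)` and `#Ш(7803q1/ℚ)[3^∞] = 1`** from GZK (`hGZK`), `ord_{s=1} L(E,s) ≤ 1`
(`hr`), the two-engine `3`-isogeny-descent certificate `Ш(E/ℚ)[3] = 0` (`h0`; 7803q1: k = 1336336, (s_φ, s_φ̂, m, EXCESS) = (1, 1, 2, 0); 7803q2: k = -36081072, (s_φ, s_φ̂, m, EXCESS) = (1, 1, 2, 0);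
engines x1b j101548 / sha-2 j103487, agreeing) and `#Ш_an = q`, `ord₃ q = 0` (`hq`, `hv`; Cremona
`#Ш_an`: 7803q1 1, 7803q2 1). PER CLASS; nothing asserted. [cite: Miller2011LMS, §1 and Def. 1.1]
[cite: Cremona1997, Table 1 (class 7803q)] -/
theorem bsdp_three_c7803q1 (hGZK : rank_eq_analyticRank_of_analyticRank_le_one)
    (hr : Records.c7803q1.analyticRank ≤ 1) (h0 : ∀ x : ↥Records.c7803q1.sha, 3 • x = 0 → x = 0)
    {q : ℚ} (hq : shaAn Records.c7803q1 = (q : ℂ)) (hv : padicValRat 3 q = 0) :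
    BSDp Records.c7803q1 3 ∧ Nat.card (AddCommGroup.primaryComponent Records.c7803q1.sha 3) = 1 :=
  JZeroThree.bsdp_three_of_noThreeTorsion _ hGZK hr h0 hq hv

/-! ### `7803r1 @ 3` (class `7803r`, `N = 7803 = 3³·17²`) -/
namespace Records
/-! Model `c7803r1 = [0, 0, 1, 0, 72]` (`y² + y = x³ + 72`; `k = 4624`; Cremona: rank `1`, `#E(ℚ)_tors = 3`,
`∏ c_ℓ = 3`, `#Ш_an = 1`) with its `IsElliptic` / `IsGloballyMinimal` instances is REUSED from
`InertCoreInstancesG.lean`. -/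

/-- `j(7803r1) = 0` (`c₄ = 0`). [cite: Cremona1997, Table 1 (curve 7803r1)] -/
theorem c7803r1_j : c7803r1.j = 0 := by
  have hc4 : c7803r1.c₄ = 0 := by
    norm_num [c7803r1, WeierstrassCurve.c₄, WeierstrassCurve.b₂, WeierstrassCurve.b₄]
  rw [WeierstrassCurve.j, hc4]
  simp

end Records

/-- **`(7803r1, 3)` is a cell of the leaf `CornerF ∧ CMRamified` at `3`** (CM by `ℚ(√−3)`,
`r_an = 1`, `3` bad and ramified), given `ord_{s=1} L(E,s) = 1` (`hr`; Cremona). [folklore] -/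
theorem cornerF_three_c7803r1 (hr : Records.c7803r1.analyticRank = 1) : CornerF Records.c7803r1 3 :=
  JZeroThree.cornerF_three_of_j_eq_zero _ Records.c7803r1_j hr

/-- **`BSD(7803r1, 3)` and `#Ш(7803r1/ℚ)[3^∞] = 1`** from GZK (`hGZK`), `ord_{s=1} L(E,s) ≤ 1`
(`hr`), the two-engine `3`-isogeny-descent certificate `Ш(E/ℚ)[3] = 0` (`h0`; 7803r1: k = 4624, (s_φ, s_φ̂, m, EXCESS) = (1, 1, 2, 0); 7803r2: k = -124848, (s_φ, s_φ̂, m, EXCESS) = (1, 1, 2, 0);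
engines x1b j101548 / sha-2 j103487, agreeing) and `#Ш_an = q`, `ord₃ q = 0` (`hq`, `hv`; Cremona
`#Ш_an`: 7803r1 1, 7803r2 1). PER CLASS; nothing asserted. [cite: Miller2011LMS, §1 and Def. 1.1]
[cite: Cremona1997, Table 1 (class 7803r)] -/
theorem bsdp_three_c7803r1 (hGZK : rank_eq_analyticRank_of_analyticRank_le_one)
    (hr : Records.c7803r1.analyticRank ≤ 1) (h0 : ∀ x : ↥Records.c7803r1.sha, 3 • x = 0 → x = 0)
    {q : ℚ} (hq : shaAn Records.c7803r1 = (q : ℂ)) (hv : padicValRat 3 q = 0) :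
    BSDp Records.c7803r1 3 ∧ Nat.card (AddCommGroup.primaryComponent Records.c7803r1.sha 3) = 1 :=
  JZeroThree.bsdp_three_of_noThreeTorsion _ hGZK hr h0 hq hv


end Summit.BirchSwinnertonDyer.Rank1Residual.X12

end
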